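import Mathlib

/-!
# Stub `stub_localToGlobal` of line `excursion-kernel-covariance`, piece (P1): abstract gluing,
# part 1 of 2 — the static estimate
# (crux `RectilinearCardy`, stmt-CriticalPhenomena-5660, route `CardyBoundaryCoulombGas`)

Pure real analysis (`ε`-bookkeeping, no percolation, no lattice). Two families `Q δ`, `ν δ` of
non-increasing functions on a parameter interval `[m₁, m₃]` ("tail functions"), with
`Q δ m₁ → 1`, `ν δ m₁ = 1`, `Q δ m₃ → 0`, `ν δ m₃ → 0` as `δ → 0⁺`, whose increments over short
windows (short = small diameter of the image under a continuous curve `γ`) are eventually small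
(tightness), and whose increments over pairs of FIXED windows inside admissible ranges eventually
satisfy the double-ratio law `ΔQ(I) Δν(J) ≈ ΔQ(J) Δν(I)` (relative error `ε`), agree in the
limit: `Q δ s - ν δ s → 0` for every `s ∈ [m₁, m₃]`, provided every range `[σ, σ'] ⊆ (m₁, m₃)`
avoiding a finite exceptional set `T` is admissible.

Proof. Cut `[m₁, m₃]` at the points of `{m₁, m₃} ∪ (T ∩ (m₁, m₃))`,
`m₁ = p₀ < p₁ < ⋯ < p_M = m₃`, and shrink each cell by a margin `w` (smaller than a third of the
minimal gap and so small that parameter windows of length `≤ 2w` are short): the good ranges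
`[p_i + w, p_{i+1} - w]` are admissible, the `2M` margins carry increments in `[0, ε]`. Summing
the double-ratio law over the good ranges compares every law window `I` with the total good
masses `A = Σ ΔQ`, `B = Σ Δν ∈ [1 - (2M+2)ε, 1 + ε]` (telescoping), whence
`|ΔQ(I) - Δν(I)| ≤ (4M+12) ε`; telescoping from `s` to `m₃` along the cells gives
`|Q δ s - ν δ s| ≤ (2 + (M+1)(4M+14)) ε` eventually, and `ε` is ours to choose.
This file proves the static (fixed-`δ`) estimate `localToGlobal_static`; the filter bookkeeping
is in part 2 (`localToGlobal_abstract`).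
-/

noncomputable section

open Set Filter Topology

namespace Summit.CriticalPhenomena.CardyFormulaZ2.Cruxes.RectilinearCardy.ExcursionKernelCovariance

/-- **Double-ratio inequality ⇒ additive closeness.** If `x, y ∈ [0, 2]`,
`A, B ∈ [1 - cε, 1 + ε]` and `|x B - A y| ≤ ε (x B + A y)` with `0 ≤ ε ≤ 1`, `0 ≤ c`, then
`|x - y| ≤ (2c + 8) ε`. [folklore] -/
theorem doubleRatio_abs_sub_le {x y A B ε c : ℝ} (hε : 0 ≤ ε) (hε1 : ε ≤ 1) (hc : 0 ≤ c)
    (hx : 0 ≤ x) (hx2 : x ≤ 2) (hy : 0 ≤ y) (hy2 : y ≤ 2)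
    (hA : 1 - c * ε ≤ A) (hA' : A ≤ 1 + ε) (hB : 1 - c * ε ≤ B) (hB' : B ≤ 1 + ε)
    (h : |x * B - A * y| ≤ ε * (x * B + A * y)) : |x - y| ≤ (2 * c + 8) * ε := by
  obtain ⟨h1, h2⟩ := abs_le.1 h
  have k1 : 0 ≤ (B - (1 - c * ε)) * (x * (1 - ε)) :=
    mul_nonneg (sub_nonneg.2 hB) (mul_nonneg hx (sub_nonneg.2 hε1))
  have k2 : 0 ≤ (1 + ε - A) * (y * (1 + ε)) :=
    mul_nonneg (sub_nonneg.2 hA') (mul_nonneg hy (by linarith))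
  have k3 : 0 ≤ c * ε * ε * x := by positivity
  have k4 : 0 ≤ (1 - ε) * (ε * y) := mul_nonneg (sub_nonneg.2 hε1) (mul_nonneg hε hy)
  have k5 : 0 ≤ (2 - x) * ((c + 1) * ε) := mul_nonneg (sub_nonneg.2 hx2) (by positivity)
  have k6 : 0 ≤ (2 - y) * ε := mul_nonneg (sub_nonneg.2 hy2) hε
  have k1' : 0 ≤ (A - (1 - c * ε)) * (y * (1 - ε)) :=
    mul_nonneg (sub_nonneg.2 hA) (mul_nonneg hy (sub_nonneg.2 hε1))
  have k2' : 0 ≤ (1 + ε - B) * (x * (1 + ε)) :=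
    mul_nonneg (sub_nonneg.2 hB') (mul_nonneg hx (by linarith))
  have k3' : 0 ≤ c * ε * ε * y := by positivity
  have k4' : 0 ≤ (1 - ε) * (ε * x) := mul_nonneg (sub_nonneg.2 hε1) (mul_nonneg hε hx)
  have k5' : 0 ≤ (2 - y) * ((c + 1) * ε) := mul_nonneg (sub_nonneg.2 hy2) (by positivity)
  have k6' : 0 ≤ (2 - x) * ε := mul_nonneg (sub_nonneg.2 hx2) hε
  rw [abs_le]
  constructor
  · linarith
  · linarith

/-- **Summing the double-ratio law over a finite family of windows.** If
`|x bⱼ - aⱼ y| ≤ ε (x bⱼ + aⱼ y)` for every `j ∈ s`, then `|x B - A y| ≤ ε (x B + A y)` for the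
totals `A = Σ aⱼ`, `B = Σ bⱼ` (triangle inequality). [folklore] -/
theorem doubleRatio_sum_le {ι : Type*} (s : Finset ι) (a b : ι → ℝ) (x y ε : ℝ)
    (h : ∀ j ∈ s, |x * b j - a j * y| ≤ ε * (x * b j + a j * y)) :
    |x * ∑ j ∈ s, b j - (∑ j ∈ s, a j) * y| ≤ ε * (x * ∑ j ∈ s, b j + (∑ j ∈ s, a j) * y) := by
  rw [Finset.mul_sum, Finset.sum_mul, ← Finset.sum_sub_distrib, ← Finset.sum_add_distrib,
    Finset.mul_sum]
  exact (Finset.abs_sum_le_sum_abs _ _).trans (Finset.sum_le_sum h)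

/-- **The static gluing estimate** (one fixed `δ`). Let `f, g` be non-increasing on `[m₁, m₃]`,
`m₁ = p 0 < p 1 < ⋯ < p M = m₃` cut points with gaps `> 2w`, `w > 0`, `0 < ε ≤ 1`; assume
`1 - ε ≤ f m₁ ≤ 1`, `g m₁ = 1`, `|f m₃|, |g m₃| ≤ ε`, that windows of length `≤ 2w` carry `f`-
and `g`-increments `≤ ε`, and that the double-ratio law with relative error `ε` holds between any
two good ranges `[p i + w, p (i+1) - w]` and between the window `[x, p (i+1) - w]` (when `x` lies
in the `i`-th good range) and every good range. Then `|f x - g x| ≤ (2 + (M+1)(4M+14)) ε`.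
[folklore] -/
theorem localToGlobal_static {f g : ℝ → ℝ} {p : ℕ → ℝ} {M : ℕ} {m₁ m₃ w ε x : ℝ}
    (hM : 0 < M) (hp0 : p 0 = m₁) (hpM : p M = m₃)
    (hgap : ∀ i < M, p i + 2 * w < p (i + 1)) (hw : 0 < w) (hε : 0 < ε) (hε1 : ε ≤ 1)
    (hf : AntitoneOn f (Icc m₁ m₃)) (hg : AntitoneOn g (Icc m₁ m₃))
    (hf1 : f m₁ ≤ 1) (hf1' : 1 - ε ≤ f m₁) (hf3 : |f m₃| ≤ ε) (hg1 : g m₁ = 1) (hg3 : |g m₃| ≤ ε)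
    (hft : ∀ s s', m₁ ≤ s → s ≤ s' → s' ≤ m₃ → s' ≤ s + 2 * w → f s - f s' ≤ ε)
    (hgt : ∀ s s', m₁ ≤ s → s ≤ s' → s' ≤ m₃ → s' ≤ s + 2 * w → g s - g s' ≤ ε)
    (hlaw : ∀ i < M, ∀ j < M,
      |(f (p i + w) - f (p (i + 1) - w)) * (g (p j + w) - g (p (j + 1) - w)) -
          (f (p j + w) - f (p (j + 1) - w)) * (g (p i + w) - g (p (i + 1) - w))| ≤
        ε * ((f (p i + w) - f (p (i + 1) - w)) * (g (p j + w) - g (p (j + 1) - w)) +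
          (f (p j + w) - f (p (j + 1) - w)) * (g (p i + w) - g (p (i + 1) - w))))
    (hlawx : ∀ i < M, p i + w ≤ x → x ≤ p (i + 1) - w → ∀ j < M,
      |(f x - f (p (i + 1) - w)) * (g (p j + w) - g (p (j + 1) - w)) -
          (f (p j + w) - f (p (j + 1) - w)) * (g x - g (p (i + 1) - w))| ≤
        ε * ((f x - f (p (i + 1) - w)) * (g (p j + w) - g (p (j + 1) - w)) +
          (f (p j + w) - f (p (j + 1) - w)) * (g x - g (p (i + 1) - w))))
    (hx : x ∈ Icc m₁ m₃) :
    |f x - g x| ≤ (2 + (M + 1) * (4 * M + 14)) * ε := by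
  have h13 : m₁ ≤ m₃ := hx.1.trans hx.2
  -- the cut points increase
  have hmono : ∀ i j : ℕ, i ≤ j → j ≤ M → p i ≤ p j := by
    intro i j hij
    induction hij with
    | refl => exact fun _ => le_rfl
    | @step j _ ih => exact fun hjM =>
        (ih (Nat.le_of_succ_le hjM)).trans (by linarith [hgap j (Nat.lt_of_succ_le hjM)])
  have hwin : ∀ i < M, m₁ ≤ p i ∧ p i + w ≤ p (i + 1) - w ∧ p (i + 1) ≤ m₃ := fun i hi =>
    ⟨hp0 ▸ hmono 0 i (Nat.zero_le i) hi.le, by linarith [hgap i hi],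
      hpM ▸ hmono (i + 1) M hi le_rfl⟩
  -- increments of non-increasing functions: nonnegative, at most `2` in total
  have hf0 : ∀ s s', m₁ ≤ s → s ≤ s' → s' ≤ m₃ → 0 ≤ f s - f s' := fun s s' h1 h2 h3 =>
    sub_nonneg.2 (hf ⟨h1, h2.trans h3⟩ ⟨h1.trans h2, h3⟩ h2)
  have hg0 : ∀ s s', m₁ ≤ s → s ≤ s' → s' ≤ m₃ → 0 ≤ g s - g s' := fun s s' h1 h2 h3 =>
    sub_nonneg.2 (hg ⟨h1, h2.trans h3⟩ ⟨h1.trans h2, h3⟩ h2)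
  have hf2 : ∀ s s', m₁ ≤ s → s ≤ s' → s' ≤ m₃ → f s - f s' ≤ 2 := by
    intro s s' h1 h2 h3
    have e1 : f s ≤ f m₁ := hf (left_mem_Icc.2 h13) ⟨h1, h2.trans h3⟩ h1
    have e2 : f m₃ ≤ f s' := hf ⟨h1.trans h2, h3⟩ (right_mem_Icc.2 h13) h3
    linarith [(abs_le.1 hf3).1]
  have hg2 : ∀ s s', m₁ ≤ s → s ≤ s' → s' ≤ m₃ → g s - g s' ≤ 2 := by
    intro s s' h1 h2 h3
    have e1 : g s ≤ g m₁ := hg (left_mem_Icc.2 h13) ⟨h1, h2.trans h3⟩ h1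
    have e2 : g m₃ ≤ g s' := hg ⟨h1.trans h2, h3⟩ (right_mem_Icc.2 h13) h3
    linarith [(abs_le.1 hg3).1]
  -- the good increments `a i`, `b i` and their totals `A`, `B`
  obtain ⟨a, ha⟩ : ∃ a : ℕ → ℝ, ∀ i, a i = f (p i + w) - f (p (i + 1) - w) := ⟨_, fun _ => rfl⟩
  obtain ⟨b, hb⟩ : ∃ b : ℕ → ℝ, ∀ i, b i = g (p i + w) - g (p (i + 1) - w) := ⟨_, fun _ => rfl⟩
  simp only [← ha, ← hb] at hlaw hlawx
  have ha0 : ∀ i < M, 0 ≤ a i := fun i hi => by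
    obtain ⟨h1, h2, h3⟩ := hwin i hi
    rw [ha]
    exact hf0 _ _ (by linarith) h2 (by linarith)
  have ha2 : ∀ i < M, a i ≤ 2 := fun i hi => by
    obtain ⟨h1, h2, h3⟩ := hwin i hi
    rw [ha]
    exact hf2 _ _ (by linarith) h2 (by linarith)
  have hb0 : ∀ i < M, 0 ≤ b i := fun i hi => by
    obtain ⟨h1, h2, h3⟩ := hwin i hi
    rw [hb]
    exact hg0 _ _ (by linarith) h2 (by linarith)
  have hb2 : ∀ i < M, b i ≤ 2 := fun i hi => by
    obtain ⟨h1, h2, h3⟩ := hwin i hi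
    rw [hb]
    exact hg2 _ _ (by linarith) h2 (by linarith)
  obtain ⟨A, hA⟩ : ∃ A : ℝ, A = ∑ i ∈ Finset.range M, a i := ⟨_, rfl⟩
  obtain ⟨B, hB⟩ : ∃ B : ℝ, B = ∑ i ∈ Finset.range M, b i := ⟨_, rfl⟩
  -- telescoping along the cells: the totals are close to `1`
  have htelf : ∑ i ∈ Finset.range M, (f (p i) - f (p (i + 1))) = f m₁ - f m₃ := by
    rw [Finset.sum_range_sub', hp0, hpM]
  have htelg : ∑ i ∈ Finset.range M, (g (p i) - g (p (i + 1))) = g m₁ - g m₃ := by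
    rw [Finset.sum_range_sub', hp0, hpM]
  have hcellf : ∀ i < M, a i ≤ f (p i) - f (p (i + 1)) ∧ f (p i) - f (p (i + 1)) ≤ a i + 2 * ε := by
    intro i hi
    obtain ⟨h1, h2, h3⟩ := hwin i hi
    have l0 := hf0 (p i) (p i + w) h1 (by linarith) (by linarith)
    have l1 := hft (p i) (p i + w) h1 (by linarith) (by linarith) (by linarith)
    have r0 := hf0 (p (i + 1) - w) (p (i + 1)) (by linarith) (by linarith) h3
    have r1 := hft (p (i + 1) - w) (p (i + 1)) (by linarith) (by linarith) h3 (by linarith)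
    rw [ha]
    constructor <;> linarith
  have hcellg : ∀ i < M, b i ≤ g (p i) - g (p (i + 1)) ∧ g (p i) - g (p (i + 1)) ≤ b i + 2 * ε := by
    intro i hi
    obtain ⟨h1, h2, h3⟩ := hwin i hi
    have l0 := hg0 (p i) (p i + w) h1 (by linarith) (by linarith)
    have l1 := hgt (p i) (p i + w) h1 (by linarith) (by linarith) (by linarith)
    have r0 := hg0 (p (i + 1) - w) (p (i + 1)) (by linarith) (by linarith) h3
    have r1 := hgt (p (i + 1) - w) (p (i + 1)) (by linarith) (by linarith) h3 (by linarith)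
    rw [hb]
    constructor <;> linarith
  have hA1 : A ≤ 1 + ε := by
    have : A ≤ f m₁ - f m₃ :=
      hA ▸ htelf ▸ Finset.sum_le_sum fun i hi => (hcellf i (Finset.mem_range.1 hi)).1
    linarith [(abs_le.1 hf3).1]
  have hA2 : 1 - (2 * M + 2) * ε ≤ A := by
    have : f m₁ - f m₃ ≤ A + M * (2 * ε) := by
      rw [← htelf, hA]
      calc ∑ i ∈ Finset.range M, (f (p i) - f (p (i + 1)))
          ≤ ∑ i ∈ Finset.range M, (a i + 2 * ε) :=
            Finset.sum_le_sum fun i hi => (hcellf i (Finset.mem_range.1 hi)).2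
        _ = _ := by
            rw [Finset.sum_add_distrib, Finset.sum_const, Finset.card_range, nsmul_eq_mul]
    linarith [(abs_le.1 hf3).2]
  have hB1 : B ≤ 1 + ε := by
    have : B ≤ g m₁ - g m₃ :=
      hB ▸ htelg ▸ Finset.sum_le_sum fun i hi => (hcellg i (Finset.mem_range.1 hi)).1
    linarith [(abs_le.1 hg3).1]
  have hB2 : 1 - (2 * M + 2) * ε ≤ B := by
    have : g m₁ - g m₃ ≤ B + M * (2 * ε) := by
      rw [← htelg, hB]
      calc ∑ i ∈ Finset.range M, (g (p i) - g (p (i + 1)))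
          ≤ ∑ i ∈ Finset.range M, (b i + 2 * ε) :=
            Finset.sum_le_sum fun i hi => (hcellg i (Finset.mem_range.1 hi)).2
        _ = _ := by
            rw [Finset.sum_add_distrib, Finset.sum_const, Finset.card_range, nsmul_eq_mul]
    have hM' : (0 : ℝ) ≤ M := Nat.cast_nonneg M
    nlinarith [(abs_le.1 hg3).2, hM', hε.le]
  -- the summed law: a law window's `f`- and `g`-increments are `(4M+12) ε`-close
  have key : ∀ u v : ℝ, 0 ≤ u → u ≤ 2 → 0 ≤ v → v ≤ 2 →
      (∀ j ∈ Finset.range M, |u * b j - a j * v| ≤ ε * (u * b j + a j * v)) →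
      |u - v| ≤ (4 * M + 12) * ε := by
    intro u v hu hu2 hv hv2 hl
    have hs := doubleRatio_sum_le _ a b u v ε hl
    rw [← hA, ← hB] at hs
    have := doubleRatio_abs_sub_le (c := 2 * M + 2) hε.le hε1 (by positivity) hu hu2 hv hv2
      hA2 hA1 hB2 hB1 hs
    linarith
  -- each cell: increments differ by at most `(4M+14) ε`
  have hseg : ∀ j < M,
      |(f (p j) - f (p (j + 1))) - (g (p j) - g (p (j + 1)))| ≤ (4 * M + 14) * ε := by
    intro j hj
    obtain ⟨h1, h2, h3⟩ := hwin j hj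
    have hab : |a j - b j| ≤ (4 * M + 12) * ε :=
      key (a j) (b j) (ha0 j hj) (ha2 j hj) (hb0 j hj) (hb2 j hj)
        fun i hi => hlaw j hj i (Finset.mem_range.1 hi)
    have l0 := hf0 (p j) (p j + w) h1 (by linarith) (by linarith)
    have l1 := hft (p j) (p j + w) h1 (by linarith) (by linarith) (by linarith)
    have r0 := hf0 (p (j + 1) - w) (p (j + 1)) (by linarith) (by linarith) h3
    have r1 := hft (p (j + 1) - w) (p (j + 1)) (by linarith) (by linarith) h3 (by linarith)
    have l0' := hg0 (p j) (p j + w) h1 (by linarith) (by linarith)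
    have l1' := hgt (p j) (p j + w) h1 (by linarith) (by linarith) (by linarith)
    have r0' := hg0 (p (j + 1) - w) (p (j + 1)) (by linarith) (by linarith) h3
    have r1' := hgt (p (j + 1) - w) (p (j + 1)) (by linarith) (by linarith) h3 (by linarith)
    rw [ha, hb] at hab
    rw [abs_le] at hab ⊢
    constructor <;> linarith
  -- telescoping the cells from `p i` to `m₃`
  have htail : ∀ n i : ℕ, i + n = M →
      |(f (p i) - f m₃) - (g (p i) - g m₃)| ≤ n * ((4 * M + 14) * ε) := by
    intro n
    induction n with
    | zero =>
      intro i hi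
      rw [add_zero] at hi
      rw [hi, hpM]
      simp
    | succ n ih =>
      intro i hi
      have hiM : i < M := by omega
      have h1 := ih (i + 1) (by omega)
      have h2 := hseg i hiM
      rw [abs_le] at h1 h2 ⊢
      push_cast
      constructor <;> linarith
  -- locate `x` in a cell `[p k, p (k+1)]`
  have hex : ∃ k, x ≤ p (k + 1) := ⟨M - 1, by rw [Nat.sub_add_cancel hM, hpM]; exact hx.2⟩
  classical
  obtain ⟨k, hk1, hkM, hk0⟩ : ∃ k, x ≤ p (k + 1) ∧ k < M ∧ p k ≤ x := by
    refine ⟨Nat.find hex, Nat.find_spec hex, ?_, ?_⟩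
    · have : Nat.find hex ≤ M - 1 :=
        Nat.find_min' hex (by rw [Nat.sub_add_cancel hM, hpM]; exact hx.2)
      omega
    · rcases Nat.eq_zero_or_pos (Nat.find hex) with h0 | hpos
      · rw [h0, hp0]; exact hx.1
      · have := Nat.find_min hex (show Nat.find hex - 1 < Nat.find hex by omega)
        rw [Nat.sub_add_cancel hpos] at this
        exact (not_le.1 this).le
  -- the first piece `[x, p (k+1)]`
  have hfirst : |(f x - f (p (k + 1))) - (g x - g (p (k + 1)))| ≤ (4 * M + 14) * ε := by
    obtain ⟨h1, h2, h3⟩ := hwin k hkM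
    have r0 := hf0 (p (k + 1) - w) (p (k + 1)) (by linarith) (by linarith) h3
    have r1 := hft (p (k + 1) - w) (p (k + 1)) (by linarith) (by linarith) h3 (by linarith)
    have r0' := hg0 (p (k + 1) - w) (p (k + 1)) (by linarith) (by linarith) h3
    have r1' := hgt (p (k + 1) - w) (p (k + 1)) (by linarith) (by linarith) h3 (by linarith)
    have hMε : 0 ≤ (4 * M + 12) * ε := by positivity
    rcases le_or_gt x (p k + w) with hxl | hxl
    · -- `x` in the left margin: `[x, p k + w]` is short, then the good range, then the right margin
      have hab : |a k - b k| ≤ (4 * M + 12) * ε :=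
        key (a k) (b k) (ha0 k hkM) (ha2 k hkM) (hb0 k hkM) (hb2 k hkM)
          fun i hi => hlaw k hkM i (Finset.mem_range.1 hi)
      have l0 := hf0 x (p k + w) hx.1 hxl (by linarith)
      have l1 := hft x (p k + w) hx.1 hxl (by linarith) (by linarith)
      have l0' := hg0 x (p k + w) hx.1 hxl (by linarith)
      have l1' := hgt x (p k + w) hx.1 hxl (by linarith) (by linarith)
      rw [ha, hb] at hab
      rw [abs_le] at hab ⊢
      constructor <;> linarith
    rcases le_or_gt x (p (k + 1) - w) with hxr | hxr
    · -- `x` in the good range: `[x, p (k+1) - w]` is a law window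
      have hu0 := hf0 x (p (k + 1) - w) hx.1 hxr (by linarith)
      have hu2 := hf2 x (p (k + 1) - w) hx.1 hxr (by linarith)
      have hv0 := hg0 x (p (k + 1) - w) hx.1 hxr (by linarith)
      have hv2 := hg2 x (p (k + 1) - w) hx.1 hxr (by linarith)
      have hab := key _ _ hu0 hu2 hv0 hv2
        fun i hi => hlawx k hkM hxl.le hxr i (Finset.mem_range.1 hi)
      rw [abs_le] at hab ⊢
      constructor <;> linarith
    · -- `x` in the right margin: `[x, p (k+1)]` is short
      have c0 := hf0 x (p (k + 1)) hx.1 hk1 h3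
      have c1 := hft x (p (k + 1)) hx.1 hk1 h3 (by linarith)
      have c0' := hg0 x (p (k + 1)) hx.1 hk1 h3
      have c1' := hgt x (p (k + 1)) hx.1 hk1 h3 (by linarith)
      rw [abs_le]
      constructor <;> linarith
  -- assemble
  have hpos : 0 ≤ (4 * M + 14) * ε := by positivity
  have hcast : ((M - (k + 1) : ℕ) : ℝ) ≤ M := by exact_mod_cast Nat.sub_le M (k + 1)
  have htl : |(f (p (k + 1)) - f m₃) - (g (p (k + 1)) - g m₃)| ≤ M * ((4 * M + 14) * ε) :=
    (htail (M - (k + 1)) (k + 1) (by omega)).trans (mul_le_mul_of_nonneg_right hcast hpos)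
  have hm3f := abs_le.1 hf3
  have hm3g := abs_le.1 hg3
  rw [abs_le] at hfirst htl ⊢
  constructor <;> nlinarith

end Summit.CriticalPhenomena.CardyFormulaZ2.Cruxes.RectilinearCardy.ExcursionKernelCovariance

end
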